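import Mathlib.Analysis.Calculus.LineDeriv.IntegrationByParts
import Mathlib.Topology.MetricSpace.Holder
import Literature.Analysis.FluidPDE.SereginSverakOffAxisScaling
import Literature.Analysis.FluidPDE.SuitableWeakRescaling
import Literature.Analysis.FluidPDE.LocalLeraySolutions
import HarnessLib

/-!
# Seregin–Zajaczkowski 2007: the off-axis a priori bound (Prop. 4.1) and its two inputs

G. Seregin, W. Zajaczkowski, *A sufficient condition of regularity for axially symmetric
solutions to the Navier–Stokes equations*, SIAM J. Math. Anal. 39 (2007) 669–685 =
arXiv:math/0702720 (section, lemma and equation numbers below are those of the arXiv version).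
The paper proves (Thm. 1.2) that an axially symmetric suitable weak solution `(v, p)` in the unit
cylinder `Q = 𝒞 × ]-1, 0[` with `sup_t ∫_𝒞 |v|²/ϱ dx < ∞` is regular at the origin. On the way it
establishes an a priori bound AWAY FROM THE AXIS which is the result other papers import from it
(Seregin–Šverák 2009, proof of Prop. 3.7, "As it was shown in [S11] …", vendored as
`SereginSverak2009.UnitScaleOffAxisBound` / `SereginSverak2009.OffAxisBound`):

> **Proposition 4.1.** Let `V` and `P` be a sufficiently smooth axially symmetric solution to the
> Navier–Stokes equations in `Q̃ = 𝒞̃ × ]-2², 0[`, where `𝒞̃ = 𝒞(1/4, 3; 2)`. Then, there exists a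
> non-decreasing function `Φ : ℝ₊ → ℝ₊` such that
> `sup_{z ∈ 𝒞(1,2;1) × ]-1,0[} (|V(z)| + |∇V(z)|) ≤ Φ(𝒜₂)`,                                 (4.1)
> `𝒜₂ = sup_{-2²<t<0} ∫_𝒞̃ |V(x,t)|² dx + ∫_Q̃ (|∇V|² + |V|³ + |P|^{3/2}) dz`.

Here `𝒞(R₁, R₂; a) = {x ∈ ℝ³ : R₁ < |x'| < R₂, |x₃| < a}` (§2). Its printed proof (§4, last
lines: "Applying Corollary 4.4 and Lemma 2.3, we end up with the proof of Proposition 4.1") has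
exactly two inputs:

> **Lemma 2.3.** Let `v` and `p` be a suitable weak solution to the Navier–Stokes equations in
> the set `Q̂ = 𝒞(3/4, 9/4; 3/2) × ]-(3/2)², 0[`. Assume that `∫_Q̂ |v(z)|⁶ dz ≤ m < +∞`. (2.6)
> Then, there exists a function `Φ₀ : ℝ₊ × ℝ₊ → ℝ₊`, nondecreasing in each variables, such that
> `|v(z)| + |∇v(z)| ≤ Φ₀(m, 𝒜_*) < +∞` (2.7) for any `z ∈ 𝒞(1,2;1) × ]-1,0[`. Here,
> `𝒜_* = ∫_Q̂ |p(z)|^{3/2} dz`.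

(proof: the pressure decay estimate (2.2) iterated along `r = τ^k/4`, Hölder from (2.6), and the
ε-regularity theory "see, for example, [LS], [ESS4], and [S8]": `C + D ≤ ε` at scale `r₀` gives
`|v(z₀)| ≤ c/r₀`, `|∇v(z₀)| ≤ c/r₀²`), and

> **Corollary 4.4.** Under assumptions of Proposition 4.1, there exists a non-decreasing
> function `Φ₆ : ℝ₊ → ℝ₊` such that `∫_{Q̃₂} |V|⁶ dz ≤ Φ₆(𝒜₂)` (4.19),
> `Q̃₂ = 𝒞̃₂ × ]-(3/2)², 0[`, `𝒞̃₂ = 𝒞(3/8, 5/2; 3/2)`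

(from Lemma 4.2 — `sup_t ∫_{𝒞̃₁} |V^a|^q ≤ Φ₁(q, 𝒜₂)`, `V^a = (V_ϱ, V₃)`, by the energy identity
(4.9) for `ω_φ ψ / ϱ` and Ladyzhenskaya's inequality in the variables `(ϱ, x₃)` — and Lemma 4.3 —
`∫_{Q̃₂} |V_φ|⁶ ≤ Φ₅(𝒜₂)`, by the energy identity (4.16) for `(ϱ V_φ ψ)²`; this is where "the
two-dimensional feature of our axially symmetric problem" away from the axis is exploited).

This file vendors Lemma 2.3 (`L6EpsilonRegularity`), Corollary 4.4 (`OffAxisL6Bound`) and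
Proposition 4.1 (`OffAxisSupBound`) as named facts, and PROVES the printed proof of Prop. 4.1:
`offAxisSupBound_of : OffAxisL6Bound → L6EpsilonRegularity → OffAxisSupBound`. The unconditional
discharges are not attempted: Lemma 2.3 rests on the Caffarelli–Kohn–Nirenberg ε-regularity
theory (held in the tree only as the named facts `lemarieRieusset_epsilon_regularity`,
`lemarieRieusset_ckn_criterion`) and on the pressure decay estimate (2.2) ([S2]); Cor. 4.4 is the
energy method of §4 (vorticity and swirl equations in cylindrical coordinates, Ladyzhenskaya's
inequality, Gronwall).

## What "sufficiently smooth" is, here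

Prop. 4.1 is printed for "sufficiently smooth axially symmetric solution[s]"; the class is pinned
down by the authors' own use of it. In §3 the blow-up limit `(u, q)` is, for each `a > 0`, "a
suitable weak solution to the Navier–Stokes equations in `Q(a)`", "Obviously, the blow up velocity
field `u` is axially symmetric and, by Caffarerrli–Kohn–Nirenberg type results, all point[s]
`y' ≠ 0` are regular which make it possible to conclude that all spatial derivatives of `u` are
Hölder continuous in a vicinity of each point with `y' ≠ 0`"; and in §5: "Functions `u^R` and
`q^R` are axially symmetric and, as it was explained before, sufficiently smooth to apply
Proposition 4.1." Seregin–Šverák 2009 likewise apply (4.1) to the axially symmetric suitable weak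
solution `(v, q)` of their Remark 3.4 (smooth off the axis by Caffarelli–Kohn–Nirenberg, their §3).
Accordingly the hypothesis structure `IsSmoothAxisymmetricSolutionOn S V P` of the two facts
records exactly: `(V, P)` is a suitable weak solution on the open set `S` (accepted
`IsSuitableWeakSolutionOn`, `ν = 1`, no force), `V` is axially symmetric at the points of `S`,
every slice `V t` is `C^∞` at the points of `S`, and ALL spatial derivatives
`(t, x) ↦ D_x^n V(t, x)` are Hölder continuous (for some exponent, in space–time) in a
neighbourhood of each point of `S`. Jointly `C²` classical solutions are in this class (they are
suitable weak solutions on every open region of their slab, accepted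
`isSuitableWeakSolutionOn_of_contDiffOn`); the zero pair is (`isSmoothAxisymmetricSolutionOn_zero`).
The symmetry of `P` (part of the paper's standing convention "`v_ϱ, v_φ, v₃` and `p` are
independent of the polar angle"; §4 uses it through `(∇P)_φ = 0` in the swirl equation (4.15)) is
not recorded as a hypothesis because it is implied by the others: for a distributional solution
whose velocity is equivariant under the rotations `R_θ` on the rotation-invariant connected shell,
`∇(P∘R_θ - P) = 0` in `𝒟'`, so `P∘R_θ - P` is a function of `t` alone, and integrating it over the
(rotation-invariant) shell shows that it vanishes. No regularity of `P` beyond `L^{3/2}_loc` is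
recorded either (the pressure enters the estimates only through `𝒜₂` and Lemma 2.3). Thus the
facts apply verbatim to the solutions the two papers apply them to; this is flagged here as a
rendering choice.

## Rendering choices (conclusions weaker than or equal to the printed ones)

* Quantifier order: `Φ`, `Φ₀`, `Φ₆` are chosen BEFORE the solution ("non-decreasing function" not
  depending on `(V, P)`, as the applications in §5 and in Seregin–Šverák 2009 require and as the
  proofs give); they are `ℝ≥0`-valued functions of `ℝ≥0` bounds `K ≥ 𝒜₂`, `m`, `𝒜_*` (for
  non-decreasing functions "`≤ Φ(𝒜₂)`" and "`≤ Φ(K)` whenever `𝒜₂ ≤ K`" are the same statement;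
  it is vacuous when `𝒜₂ = ∞`).
* `𝒜₂` is the accepted `SereginSverak2009.szEnergy V P G` (`sup_t` as an essential supremum over
  `]-4, 0[` — for `V` continuous on `Q̃` the map `t ↦ ∫_𝒞̃ |V|²` is lower semicontinuous, so this
  is the supremum —, `|∇V|²` the squared Frobenius norm of a spatial gradient `G`); for the smooth class
  `G` is the classical gradient `(t, x) ↦ D(V t)(x)`, which is proved here to be a weak spatial
  gradient (`hasWeakSpatialGradientOn_fderiv`), so by a.e. uniqueness of weak gradients nothing
  depends on this choice. `|∇V(z)|` in (4.1), (2.7) is `√(frobeniusNormSq (D(V t) x))`.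
* Lemma 2.3 is stated for suitable weak solutions (Def. 1.1 of the paper = Lin's definition; the
  accepted `IsSuitableWeakSolutionOn` on the open set `Q̂` has the same local content), with "for
  any `z`" rendered almost everywhere on `𝒞(1,2;1) × ]-1,0[` and `∇v` any weak spatial gradient of
  `v` on `Q̂` (for suitable weak solutions the printed pointwise values refer to the regular
  representative); `m`, `𝒜_*` are upper bounds of `∫_Q̂ |v|⁶`, `∫_Q̂ |p|^{3/2}`.
* Prop. 4.1 and Cor. 4.4 conclude POINTWISE on the open set `𝒞(1,2;1) × ]-1,0[` (= `sup ≤`), as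
  printed, for the smooth class.
* Geometry: `shellCyl R₁ R₂ a b = 𝒞(R₁, R₂; a) × ]-b², 0[` (time first); `Q̃ = shellCyl (1/4) 3 2 2`
  is the accepted `SereginSverak2009.outerShell 1 0` and `𝒞(1,2;1) × ]-1,0[ = shellCyl 1 2 1 1` is
  `SereginSverak2009.innerShell 1 0` (`outerShell_one_eq`, `innerShell_one_eq`), so that
  `OffAxisSupBound` is literally the inequality (as15) consumed in Seregin–Šverák 2009.

## Contents

* geometry `shell`, `shellCyl`, `shellCylOpens` and their elementary properties;
* `IsAxisymmetricOn`, `IsSmoothAxisymmetricSolutionOn` (the hypothesis class, nothing asserted) and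
  its consequences `continuousOn_velocity`, `continuousOn_fderiv`;
* `hasWeakSpatialGradientOn_fderiv`: the classical spatial gradient of a field which is `C¹` in
  `x` at the points of an open `U ⊆ ℝ × ℝ³`, with `V` and `D_x V` continuous on `U`, is a weak
  spatial gradient on `U` (integration by parts slice by slice, Mathlib's
  `integral_mul_fderiv_eq_neg_fderiv_mul_of_integrable`);
* `isSmoothAxisymmetricSolutionOn_zero`: the zero pair inhabits the class (non-vacuity);
* the named facts `L6EpsilonRegularity` (Lemma 2.3), `OffAxisL6Bound` (Cor. 4.4),
  `OffAxisSupBound` (Prop. 4.1), and the proved `offAxisSupBound_of` (the printed proof of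
  Prop. 4.1: restrict to `Q̂ ⊆ Q̃₂ ⊆ Q̃`, feed `m = Φ₆(𝒜₂)` and `𝒜_* ≤ 𝒜₂` to Lemma 2.3, and pass
  from the a.e. bound to the pointwise one by continuity, accepted
  `SereginSverak2009.forall_le_of_ae_le_of_continuousOn`; `Φ = Φ₀(Φ₆(·), ·)`).

## Not here

Thm. 1.2 itself, Lemmas 2.1, 2.2, 2.4, (2.1)–(2.2), Lemmas 4.2–4.3 (the two halves of Cor. 4.4),
§3 and §5 (blow-up and backward uniqueness); the reduction of `SereginSverak2009.UnitScaleOffAxisBound`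
to `OffAxisSupBound` (it needs, besides Seregin–Šverák's Remark 3.4 = `SereginSverak2009.SuitableOfBounded`,
the off-axis smoothness of axially symmetric suitable weak solutions, i.e. the CKN statement
quoted above, for a representative of the `L³` field).

## References

* G. Seregin, W. Zajaczkowski, SIAM J. Math. Anal. 39 (2007) 669–685, arXiv:math/0702720: §1
  (Def. 1.1, standing symmetry convention), §2 (functionals `A, C, E, D`, (2.1)–(2.2), sets
  `𝒞(R₁,R₂;a)`, Lemma 2.3 with (2.6)–(2.8) and its proof), §3 (the sentence on off-axis
  regularity of the blow-up limit), §4 (Prop. 4.1 (4.1), Lemma 4.2 (4.2), Lemma 4.3 (4.14),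
  Cor. 4.4 (4.19), proof of Prop. 4.1), §5 (application of Prop. 4.1 to `u^R`).
  [`SereginZajaczkowski2007`]
* G. Seregin, V. Šverák, Comm. PDE 34 (2009) 171–201, arXiv:0804.1803, §3: Remark 3.4, proof of
  Prop. 3.7 ((as15) = (4.1) for the rescaled solution). [`SereginSverak2009`]
* O. A. Ladyzhenskaya, G. A. Seregin, J. Math. Fluid Mech. 1 (1999) 356–387 ([LS] of the paper:
  ε-regularity and Hölder continuity of spatial derivatives near regular points).
* L. Caffarelli, R. Kohn, L. Nirenberg, Comm. Pure Appl. Math. 35 (1982) 771–831.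
  [`CaffarelliKohnNirenberg1982`]
-/

noncomputable section

open MeasureTheory Set Function Filter Topology TopologicalSpace Metric
open scoped NNReal ENNReal ContDiff InnerProductSpace RealInnerProductSpace

namespace Literature.Analysis.FluidPDE

namespace SereginZajaczkowski2007

open SereginSverak2009

/-- Local notation for physical space `ℝ³ = EuclideanSpace ℝ (Fin 3)`. -/
local notation "ℝ³" => EuclideanSpace ℝ (Fin 3)

/-! ### The shells `𝒞(R₁, R₂; a)` and the cylinders `𝒞(R₁, R₂; a) × ]-b², 0[` -/

/-- The spatial shell `𝒞(R₁, R₂; a) = {x ∈ ℝ³ : R₁ < |x'| < R₂, |x₃| < a}` of Seregin–Zajaczkowski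
2007, §2 (`|x'| = cylRadius x`). [cite: SereginZajaczkowski2007, §2 (definition of 𝒞(R₁,R₂;a))] -/
def shell (R₁ R₂ a : ℝ) : Set ℝ³ :=
  {x | cylRadius x ∈ Ioo R₁ R₂ ∧ |x 2| < a}

/-- The space–time shell cylinder `𝒞(R₁, R₂; a) × ]-b², 0[` (time first), e.g.
`Q̃ = 𝒞(1/4,3;2) × ]-2²,0[`, `Q̂ = 𝒞(3/4,9/4;3/2) × ]-(3/2)²,0[`, `Q̃₂ = 𝒞(3/8,5/2;3/2) × ]-(3/2)²,0[`
and the target set `𝒞(1,2;1) × ]-1,0[` of Seregin–Zajaczkowski 2007, Lemma 2.3 and §4.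
[cite: SereginZajaczkowski2007, Lemma 2.3 and Prop. 4.1 (the sets Q̂, Q̃, Q̃₁, Q̃₂)] -/
def shellCyl (R₁ R₂ a b : ℝ) : Set (ℝ × ℝ³) :=
  {z | z.1 ∈ Ioo (-b ^ 2) 0 ∧ z.2 ∈ shell R₁ R₂ a}

/-- Membership in `𝒞(R₁, R₂; a)`, unfolded. [cite: SereginZajaczkowski2007, §2] -/
theorem mem_shell {R₁ R₂ a : ℝ} {x : ℝ³} :
    x ∈ shell R₁ R₂ a ↔ cylRadius x ∈ Ioo R₁ R₂ ∧ |x 2| < a :=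
  Iff.rfl

/-- Membership in `𝒞(R₁, R₂; a) × ]-b², 0[`, unfolded. [cite: SereginZajaczkowski2007, §2] -/
theorem mem_shellCyl {R₁ R₂ a b : ℝ} {z : ℝ × ℝ³} :
    z ∈ shellCyl R₁ R₂ a b ↔ z.1 ∈ Ioo (-b ^ 2) 0 ∧ cylRadius z.2 ∈ Ioo R₁ R₂ ∧ |z.2 2| < a :=
  Iff.rfl

/-- The shells `𝒞(R₁, R₂; a)` are open. [folklore] -/
theorem isOpen_shell (R₁ R₂ a : ℝ) : IsOpen (shell R₁ R₂ a) := by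
  have h2 : Continuous fun x : ℝ³ => |x 2| := by fun_prop
  exact (isOpen_Ioo.preimage continuous_cylRadius).inter (isOpen_lt h2 continuous_const)

/-- The shell cylinders are open. [folklore] -/
theorem isOpen_shellCyl (R₁ R₂ a b : ℝ) : IsOpen (shellCyl R₁ R₂ a b) :=
  (isOpen_Ioo.preimage continuous_fst).inter ((isOpen_shell R₁ R₂ a).preimage continuous_snd)

/-- The shell cylinders are measurable. [folklore] -/
theorem measurableSet_shellCyl (R₁ R₂ a b : ℝ) : MeasurableSet (shellCyl R₁ R₂ a b) :=
  (isOpen_shellCyl R₁ R₂ a b).measurableSet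

/-- The shell cylinder `𝒞(R₁, R₂; a) × ]-b², 0[` as an open set of space–time.
[cite: SereginZajaczkowski2007, §2] -/
def shellCylOpens (R₁ R₂ a b : ℝ) : Opens (ℝ × ℝ³) :=
  ⟨shellCyl R₁ R₂ a b, isOpen_shellCyl R₁ R₂ a b⟩

/-- The carrier of `shellCylOpens`. [folklore] -/
@[simp]
theorem coe_shellCylOpens (R₁ R₂ a b : ℝ) :
    ((shellCylOpens R₁ R₂ a b : Opens (ℝ × ℝ³)) : Set (ℝ × ℝ³)) = shellCyl R₁ R₂ a b :=
  rfl

/-- Monotonicity of the shell cylinders in the four parameters (`0 ≤ b ≤ b'`). [folklore] -/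
theorem shellCyl_mono {R₁ R₂ a b R₁' R₂' a' b' : ℝ} (h₁ : R₁' ≤ R₁) (h₂ : R₂ ≤ R₂') (ha : a ≤ a')
    (hb : 0 ≤ b) (hb' : b ≤ b') : shellCyl R₁ R₂ a b ⊆ shellCyl R₁' R₂' a' b' := by
  intro z hz
  rw [mem_shellCyl] at hz ⊢
  have hbb : b ^ 2 ≤ b' ^ 2 := pow_le_pow_left₀ hb hb' 2
  exact ⟨⟨by linarith [hz.1.1], hz.1.2⟩, ⟨lt_of_le_of_lt h₁ hz.2.1.1, lt_of_lt_of_le hz.2.1.2 h₂⟩,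
    lt_of_lt_of_le hz.2.2 ha⟩

/-- The same monotonicity for the open sets. [folklore] -/
theorem shellCylOpens_mono {R₁ R₂ a b R₁' R₂' a' b' : ℝ} (h₁ : R₁' ≤ R₁) (h₂ : R₂ ≤ R₂')
    (ha : a ≤ a') (hb : 0 ≤ b) (hb' : b ≤ b') :
    shellCylOpens R₁ R₂ a b ≤ shellCylOpens R₁' R₂' a' b' :=
  shellCyl_mono h₁ h₂ ha hb hb'

/-- The shells are invariant under the rotations about the axis. [folklore] -/
theorem rotZ_mem_shell_iff {R₁ R₂ a : ℝ} (θ : ℝ) {x : ℝ³} :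
    rotZ θ x ∈ shell R₁ R₂ a ↔ x ∈ shell R₁ R₂ a := by
  rw [mem_shell, mem_shell, cylRadius_rotZ, rotZ_apply_two]

/-- `Q̃ = 𝒞(1/4, 3; 2) × ]-2², 0[` is the shell `Q²₁(0)` of Seregin–Šverák 2009 (accepted
`SereginSverak2009.outerShell 1 0`). [cite: SereginZajaczkowski2007, Prop. 4.1 (the set Q̃)] -/
theorem outerShell_one_eq : outerShell 1 0 = shellCyl (1 / 4) 3 2 2 := by
  ext z
  rw [mem_outerShell, mem_outerShellSpace, mem_shellCyl, sub_zero]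
  norm_num

/-- `𝒞(1, 2; 1) × ]-1, 0[` is the shell `Q¹₁(0)` of Seregin–Šverák 2009 (accepted
`SereginSverak2009.innerShell 1 0`). [cite: SereginZajaczkowski2007, Prop. 4.1 (4.1) (the set 𝒞(1,2;1)×]-1,0[)] -/
theorem innerShell_one_eq : innerShell 1 0 = shellCyl 1 2 1 1 := by
  ext z
  rw [mem_innerShell, mem_shellCyl, sub_zero]
  norm_num

/-- `Q̂ ⊆ Q̃₂`. [cite: SereginZajaczkowski2007, proof of Prop. 4.1] -/
theorem shellCyl_hat_subset_two :
    shellCyl (3 / 4) (9 / 4) (3 / 2) (3 / 2) ⊆ shellCyl (3 / 8) (5 / 2) (3 / 2) (3 / 2) :=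
  shellCyl_mono (by norm_num) (by norm_num) le_rfl (by norm_num) le_rfl

/-- `Q̂ ⊆ Q̃`. [cite: SereginZajaczkowski2007, proof of Prop. 4.1] -/
theorem shellCyl_hat_subset_tilde :
    shellCyl (3 / 4) (9 / 4) (3 / 2) (3 / 2) ⊆ shellCyl (1 / 4) 3 2 2 :=
  shellCyl_mono (by norm_num) (by norm_num) (by norm_num) (by norm_num) (by norm_num)

/-- `Q̃₂ ⊆ Q̃`. [cite: SereginZajaczkowski2007, Cor. 4.4] -/
theorem shellCyl_two_subset_tilde :
    shellCyl (3 / 8) (5 / 2) (3 / 2) (3 / 2) ⊆ shellCyl (1 / 4) 3 2 2 :=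
  shellCyl_mono (by norm_num) (by norm_num) (by norm_num) (by norm_num) (by norm_num)

/-- `𝒞(1,2;1) × ]-1,0[ ⊆ Q̂`. [cite: SereginZajaczkowski2007, Lemma 2.3] -/
theorem shellCyl_one_subset_hat :
    shellCyl 1 2 1 1 ⊆ shellCyl (3 / 4) (9 / 4) (3 / 2) (3 / 2) :=
  shellCyl_mono (by norm_num) (by norm_num) (by norm_num) (by norm_num) (by norm_num)

/-! ### Axial symmetry and the smoothness class of Proposition 4.1 -/

/-- Axial symmetry of a time-dependent vector field at the points of a space–time set `S`:
`V(t, R_θ x) = R_θ V(t, x)` for all rotations `R_θ` about the `x₃`-axis and all `(t, x) ∈ S`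
("`v_ϱ, v_φ, v₃` … are independent of the polar angle `φ`", Seregin–Zajaczkowski 2007, §1).
For `S = ℝ × ℝ³` this is `IsAxisymmetric (V t)` for every `t`.
[cite: SereginZajaczkowski2007, §1 (standing symmetry convention)] -/
def IsAxisymmetricOn (S : Set (ℝ × ℝ³)) (V : ℝ → ℝ³ → ℝ³) : Prop :=
  ∀ θ : ℝ, ∀ z ∈ S, V z.1 (rotZ θ z.2) = rotZ θ (V z.1 z.2)

/-- Slicewise axisymmetric fields are axisymmetric on every set whose times lie in the given
time set. [folklore] -/
theorem isAxisymmetricOn_of_isAxisymmetric {I : Set ℝ} {S : Set (ℝ × ℝ³)} {V : ℝ → ℝ³ → ℝ³}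
    (hV : ∀ t ∈ I, IsAxisymmetric (V t)) (hS : ∀ z ∈ S, z.1 ∈ I) : IsAxisymmetricOn S V :=
  fun θ z hz => hV z.1 (hS z hz) θ z.2

/-- **The hypotheses of Seregin–Zajaczkowski 2007, Prop. 4.1** ("a sufficiently smooth axially
symmetric solution to the Navier–Stokes equations in" the open set `S`), in the reading fixed by
the authors' applications (module docstring): `(V, P)` is a suitable weak solution of the
Navier–Stokes system (`ν = 1`, no force) on `S`; `V` is axially symmetric at the points of `S`;
every slice `V t` is `C^∞` at the points of `S`; and "all spatial derivatives of [`V`] are Hölder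
continuous in a vicinity of each point" of `S` (§3), i.e. for every order `n` and every `z ∈ S`
the space–time map `(t, x) ↦ D_xⁿ V(t, x)` is Hölder continuous, with some positive exponent, on
a neighbourhood of `z` within `S`. A hypothesis structure; nothing is asserted.
[cite: SereginZajaczkowski2007, Prop. 4.1 (hypotheses), with §3 and §5 (the class it is applied to)] -/
structure IsSmoothAxisymmetricSolutionOn (S : Opens (ℝ × ℝ³)) (V : ℝ → ℝ³ → ℝ³)
    (P : ℝ → ℝ³ → ℝ) : Prop where
  /-- `(V, P)` is a suitable weak solution on `S` (`ν = 1`, `f = 0`). -/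
  suitable : IsSuitableWeakSolutionOn S 1 0 V P
  /-- `V` is axially symmetric at the points of `S`. -/
  axisymmetric : IsAxisymmetricOn (S : Set (ℝ × ℝ³)) V
  /-- every slice `V t` is smooth at the points of `S`. -/
  contDiffAt : ∀ z ∈ (S : Set (ℝ × ℝ³)), ContDiffAt ℝ ∞ (V z.1) z.2
  /-- all spatial derivatives are locally Hölder continuous in space–time on `S`. -/
  holder : ∀ n : ℕ, ∀ z ∈ (S : Set (ℝ × ℝ³)), ∃ U ∈ 𝓝 z, ∃ C r : ℝ≥0, 0 < r ∧
    HolderOnWith C r (fun w : ℝ × ℝ³ => iteratedFDeriv ℝ n (V w.1) w.2) (U ∩ (S : Set (ℝ × ℝ³)))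

namespace IsSmoothAxisymmetricSolutionOn

variable {S : Opens (ℝ × ℝ³)} {V : ℝ → ℝ³ → ℝ³} {P : ℝ → ℝ³ → ℝ}

/-- The spatial derivatives of every order are continuous on `S` in space–time. [folklore] -/
theorem continuousOn_iteratedFDeriv (h : IsSmoothAxisymmetricSolutionOn S V P) (n : ℕ) :
    ContinuousOn (fun w : ℝ × ℝ³ => iteratedFDeriv ℝ n (V w.1) w.2) (S : Set (ℝ × ℝ³)) := by
  intro z hz
  obtain ⟨U, hU, C, r, hr, hH⟩ := h.holder n z hz
  have hc : ContinuousWithinAt (fun w : ℝ × ℝ³ => iteratedFDeriv ℝ n (V w.1) w.2)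
      ((S : Set (ℝ × ℝ³)) ∩ U) z := by
    rw [inter_comm]
    exact hH.continuousOn hr z ⟨mem_of_mem_nhds hU, hz⟩
  exact (continuousWithinAt_inter hU).1 hc

/-- The velocity is continuous on `S` in space–time. [folklore] -/
theorem continuousOn_velocity (h : IsSmoothAxisymmetricSolutionOn S V P) :
    ContinuousOn (uncurry V) (S : Set (ℝ × ℝ³)) := by
  have h0 := h.continuousOn_iteratedFDeriv 0
  have heq : uncurry V = (continuousMultilinearCurryFin0 ℝ ℝ³ ℝ³) ∘
      fun w : ℝ × ℝ³ => iteratedFDeriv ℝ 0 (V w.1) w.2 := by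
    funext w
    simp only [comp_apply, uncurry]
    rfl
  rw [heq]
  exact (continuousMultilinearCurryFin0 ℝ ℝ³ ℝ³).continuous.comp_continuousOn h0

/-- The classical spatial gradient is continuous on `S` in space–time. [folklore] -/
theorem continuousOn_fderiv (h : IsSmoothAxisymmetricSolutionOn S V P) :
    ContinuousOn (fun w : ℝ × ℝ³ => fderiv ℝ (V w.1) w.2) (S : Set (ℝ × ℝ³)) := by
  have h1 := h.continuousOn_iteratedFDeriv 1
  have heq : (fun w : ℝ × ℝ³ => fderiv ℝ (V w.1) w.2) = (continuousMultilinearCurryFin1 ℝ ℝ³ ℝ³) ∘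
      fun w : ℝ × ℝ³ => iteratedFDeriv ℝ 1 (V w.1) w.2 := by
    funext w
    ext v
    simp only [comp_apply, continuousMultilinearCurryFin1_apply, iteratedFDeriv_one_apply]
    rfl
  rw [heq]
  exact (continuousMultilinearCurryFin1 ℝ ℝ³ ℝ³).continuous.comp_continuousOn h1

/-- Every slice is differentiable at the points of `S`. [folklore] -/
theorem differentiableAt (h : IsSmoothAxisymmetricSolutionOn S V P) {z : ℝ × ℝ³}
    (hz : z ∈ (S : Set (ℝ × ℝ³))) : DifferentiableAt ℝ (V z.1) z.2 :=
  (h.contDiffAt z hz).differentiableAt (by simp)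

/-- Restriction to a smaller open set. [folklore] -/
theorem of_le {S' : Opens (ℝ × ℝ³)} (h : IsSmoothAxisymmetricSolutionOn S V P) (hS : S' ≤ S) :
    IsSmoothAxisymmetricSolutionOn S' V P where
  suitable := h.suitable.of_le hS
  axisymmetric θ z hz := h.axisymmetric θ z (hS hz)
  contDiffAt z hz := h.contDiffAt z (hS hz)
  holder n z hz := by
    obtain ⟨U, hU, C, r, hr, hH⟩ := h.holder n z (hS hz)
    exact ⟨U, hU, C, r, hr, hH.mono (inter_subset_inter_right _ hS)⟩

end IsSmoothAxisymmetricSolutionOn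

/-- **Non-vacuity of the class**: the zero pair `(V, P) = (0, 0)` satisfies the hypotheses of
Prop. 4.1 on every open set (it is a suitable weak solution, accepted
`isSuitableWeakSolutionOn_zero`; it is equivariant; its spatial derivatives are constant).
[folklore] -/
theorem isSmoothAxisymmetricSolutionOn_zero (S : Opens (ℝ × ℝ³)) :
    IsSmoothAxisymmetricSolutionOn S 0 0 where
  suitable := isSuitableWeakSolutionOn_zero S 1
  axisymmetric θ z _ := by
    show (0 : ℝ³) = rotZ θ 0
    ext i
    fin_cases i <;> simp [rotZ]
  contDiffAt _ _ := contDiffAt_const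
  holder n z _ := ⟨univ, univ_mem, 0, 1, one_pos, fun a _ b _ => by simp⟩

/-! ### Classical spatial gradients are weak spatial gradients -/

/-- A product `f · g` with `f` continuous, `tsupport f ⊆ W`, `W` open, and `g` continuous on `W`,
is continuous (it vanishes near every point outside `W`). [folklore] -/
theorem continuous_mul_of_tsupport_subset {f g : ℝ³ → ℝ} {W : Set ℝ³} (hW : IsOpen W)
    (hf : Continuous f) (hfW : tsupport f ⊆ W) (hg : ContinuousOn g W) :
    Continuous fun x => f x * g x := by
  rw [continuous_iff_continuousAt]
  intro x
  by_cases hx : x ∈ W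
  · exact hf.continuousAt.mul (hg.continuousAt (hW.mem_nhds hx))
  · have hx' : x ∉ tsupport f := fun h => hx (hfW h)
    have h0 : (fun y => f y * g y) =ᶠ[𝓝 x] fun _ => 0 := by
      filter_upwards [notMem_tsupport_iff_eventuallyEq.1 hx'] with y hy
      rw [hy, Pi.zero_apply, zero_mul]
    exact (continuousAt_const.congr h0.symm)

/-- **Classical spatial gradients are weak spatial gradients.** Let `U ⊆ ℝ × ℝ³` be open and let
`V : ℝ → ℝ³ → ℝ³` be continuous on `U`, differentiable in `x` at every point of `U`, with
`(t, x) ↦ D(V t)(x)` continuous on `U`. Then `(t, x) ↦ D(V t)(x)` is a weak spatial gradient of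
`V` on `U` in the sense of the accepted `HasWeakSpatialGradientOn`: for `φ ∈ C_c^∞(U)`,
integration by parts in `x` on each time slice has no boundary terms (Evans, *PDE*, §5.2.1,
motivation of the definition; Mathlib's `integral_mul_fderiv_eq_neg_fderiv_mul_of_integrable`).
[folklore] -/
theorem hasWeakSpatialGradientOn_fderiv {U : Opens (ℝ × ℝ³)} {V : ℝ → ℝ³ → ℝ³}
    (h0 : ContinuousOn (uncurry V) (U : Set (ℝ × ℝ³)))
    (h1 : ContinuousOn (fun z : ℝ × ℝ³ => fderiv ℝ (V z.1) z.2) (U : Set (ℝ × ℝ³)))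
    (hd : ∀ z ∈ (U : Set (ℝ × ℝ³)), DifferentiableAt ℝ (V z.1) z.2) :
    HasWeakSpatialGradientOn U V (fun t x => fderiv ℝ (V t) x) where
  locallyIntegrableOn := h0.locallyIntegrableOn U.isOpen.measurableSet
  locallyIntegrableOn_grad := h1.locallyIntegrableOn U.isOpen.measurableSet
  integral_fderiv_mul_inner_eq φ hφ v w := by
    rw [← integral_neg]
    refine integral_congr_ae (Eventually.of_forall fun t => ?_)
    dsimp only
    -- the slice at time `t`
    set Ut : Set ℝ³ := {x | (t, x) ∈ (U : Set (ℝ × ℝ³))} with hUt_def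
    have hmk : Continuous fun x : ℝ³ => ((t, x) : ℝ × ℝ³) := continuous_const.prodMk continuous_id
    have hUt : IsOpen Ut := U.isOpen.preimage hmk
    have hK : IsCompact (tsupport (uncurry φ)) := hφ.hasCompactSupport
    have hsub1 : tsupport (φ t) ⊆ (fun x : ℝ³ => ((t, x) : ℝ × ℝ³)) ⁻¹' tsupport (uncurry φ) := by
      refine closure_minimal (fun x hx => ?_) ((isClosed_tsupport _).preimage hmk)
      exact subset_closure (by simpa [mem_support] using hx)
    have hcpt : HasCompactSupport (φ t) :=
      IsCompact.of_isClosed_subset (hK.image continuous_snd) (isClosed_tsupport _)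
        (hsub1.trans fun x hx => ⟨(t, x), hx, rfl⟩)
    have hsubU : tsupport (φ t) ⊆ Ut := hsub1.trans fun x hx => hφ.tsupport_subset hx
    have hφt : ContDiff ℝ ∞ (φ t) := hφ.contDiff_slice t
    have hφd : Differentiable ℝ (φ t) := hφt.differentiable (by simp)
    have hφc : Continuous (φ t) := hφt.continuous
    have hφ'c : Continuous fun x => fderiv ℝ (φ t) x v :=
      (hφt.continuous_fderiv (by simp)).clm_apply continuous_const
    -- the functions `g = ⟪V t ·, w⟫` and `g' = ⟪D(V t) · v, w⟫` on the slice
    set g : ℝ³ → ℝ := fun x => ⟪V t x, w⟫ with hg_def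
    have hVt : ContinuousOn (V t) Ut := fun x hx =>
      (h0.continuousAt (U.isOpen.mem_nhds hx)).comp_continuousWithinAt
        (hmk.continuousWithinAt : ContinuousWithinAt _ Ut x)
    have hgc : ContinuousOn g Ut := hVt.inner continuousOn_const
    have hDc : ContinuousOn (fun x => fderiv ℝ (V t) x) Ut := fun x hx =>
      (h1.continuousAt (U.isOpen.mem_nhds hx)).comp_continuousWithinAt
        (hmk.continuousWithinAt : ContinuousWithinAt _ Ut x)
    have hg'c : ContinuousOn (fun x => ⟪fderiv ℝ (V t) x v, w⟫) Ut :=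
      (hDc.clm_apply continuousOn_const).inner continuousOn_const
    have hgd : ∀ x ∈ Ut, DifferentiableAt ℝ g x := fun x hx =>
      (hd (t, x) hx).inner ℝ (differentiableAt_const w)
    have hg' : ∀ x ∈ Ut, fderiv ℝ g x v = ⟪fderiv ℝ (V t) x v, w⟫ := by
      intro x hx
      rw [hg_def, fderiv_inner_apply ℝ (hd (t, x) hx) (differentiableAt_const w)]
      simp
    have hg'c' : ContinuousOn (fun x => fderiv ℝ g x v) Ut := hg'c.congr hg'
    -- integrability of the three products (continuous with compact support)
    have hsub' : tsupport (fun x => fderiv ℝ (φ t) x v) ⊆ Ut :=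
      (tsupport_fderiv_apply_subset ℝ v).trans hsubU
    have i1 : Integrable (fun x => fderiv ℝ (φ t) x v * g x) :=
      (continuous_mul_of_tsupport_subset hUt hφ'c hsub' hgc).integrable_of_hasCompactSupport
        ((hcpt.fderiv_apply (𝕜 := ℝ) v).mul_right)
    have i2 : Integrable (fun x => φ t x * fderiv ℝ g x v) :=
      (continuous_mul_of_tsupport_subset hUt hφc hsubU hg'c').integrable_of_hasCompactSupport
        hcpt.mul_right
    have i3 : Integrable (fun x => φ t x * g x) :=
      (continuous_mul_of_tsupport_subset hUt hφc hsubU hgc).integrable_of_hasCompactSupport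
        hcpt.mul_right
    have ibp := integral_mul_fderiv_eq_neg_fderiv_mul_of_integrable (μ := volume) i1 i2 i3
      (fun x _ => hφd x) (fun x hx => hgd x (hsubU hx))
    -- `∫ φ ⟪D(V t) v, w⟫ = ∫ φ ∂_v g`
    have hlhs : ∫ x, φ t x * ⟪fderiv ℝ (V t) x v, w⟫ = ∫ x, φ t x * fderiv ℝ g x v := by
      refine integral_congr_ae (Eventually.of_forall fun x => ?_)
      dsimp only
      by_cases hx : φ t x = 0
      · rw [hx, zero_mul, zero_mul]
      · rw [hg' x (hsubU (subset_closure hx))]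
    rw [hlhs, ibp, neg_neg]

/-! ### Lemma 2.3, Corollary 4.4 and Proposition 4.1 as named facts -/

/-- **Seregin–Zajaczkowski 2007, Lemma 2.3.** "Let `v` and `p` be a suitable weak solution to the
Navier–Stokes equations in the set `Q̂ = 𝒞(3/4, 9/4; 3/2) × ]-(3/2)², 0[`. Assume that
`∫_Q̂ |v(z)|⁶ dz ≤ m < +∞`. Then, there exists a function `Φ₀ : ℝ₊ × ℝ₊ → ℝ₊`, nondecreasing in
each variables, such that `|v(z)| + |∇v(z)| ≤ Φ₀(m, 𝒜_*) < +∞` for any `z ∈ 𝒞(1,2;1) × ]-1,0[`.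
Here, `𝒜_* = ∫_Q̂ |p(z)|^{3/2} dz`." (Proof there: `Q(z₀, 1/4) ⊂ Q̂` for every
`z₀ ∈ 𝒞(1,2;1) × ]-1,0[`; the pressure decay estimate (2.2), proved in [S2], iterated along
`r = τ^k/4`; Hölder from (2.6); and the ε-regularity theory of [LS, ESS4, S8]: `C + D ≤ ε` at scale
`r₀` gives `|v(z₀)| ≤ c/r₀`, `|∇v(z₀)| ≤ c/r₀²`.) "Suitable weak solution" is Def. 1.1 of the paper
(F.-H. Lin's form: `v ∈ L_{2,∞} ∩ W^{1,0}_2`, `p ∈ L_{3/2}`, the equations in the sense of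
distributions, the local energy inequality), used in a space–time cylinder in the local sense of §2.
Rendered (module docstring): the accepted `IsSuitableWeakSolutionOn` on the open set `Q̂` (`ν = 1`,
no force: distributional equations, local classes, the local energy inequality tested against
`C_c^∞(Q̂)`) TOGETHER WITH Def. 1.1's classes on `Q̂` as printed — `v ∈ L_{2,∞}(Q̂)`
(`t ↦ ∫_{𝒞(3/4,9/4;3/2)} |v(x,t)|² dx` essentially bounded on `]-(3/2)², 0[`), `∇v = G ∈ L₂(Q̂)` for
the weak spatial gradient `G` through which `|∇v|` is computed, `p ∈ L_{3/2}(Q̂)` (through the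
bound `𝒜_* ≤ a`). With these classes the `C_c^∞(Q̂)`-tested inequality yields the printed "for
a.a. `t`" form by the usual time cut-off, i.e. Def. 1.1 written for `Q̂`, which in turn implies the
local notion of §2 ("suitable in `Q(z₀, R)` for some `R > 0`" around every point) in which the
lemma is stated; so the hypotheses here are at least the printed ones. `Φ₀` is chosen before the
solution; `m`, `𝒜_*` are upper bounds in `ℝ≥0`; the conclusion is almost everywhere on
`𝒞(1,2;1) × ]-1,0[` with `|∇v| = √(frobeniusNormSq G)`. The pressure decay estimate (2.2) is
quoted there from [S2] = G. Seregin, Comm. Pure Appl. Math. 54 (2001) 1019–1028.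
[cite: SereginZajaczkowski2007, Lemma 2.3 ((2.6)–(2.7)), with Def. 1.1 and §2] -/
def L6EpsilonRegularity : Prop :=
  ∃ Φ₀ : ℝ≥0 → ℝ≥0 → ℝ≥0, (∀ m, Monotone (Φ₀ m)) ∧ (∀ a, Monotone fun m => Φ₀ m a) ∧
    ∀ (v : ℝ → ℝ³ → ℝ³) (p : ℝ → ℝ³ → ℝ) (G : ℝ → ℝ³ → ℝ³ →L[ℝ] ℝ³),
      IsSuitableWeakSolutionOn (shellCylOpens (3 / 4) (9 / 4) (3 / 2) (3 / 2)) 1 0 v p →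
      HasWeakSpatialGradientOn (shellCylOpens (3 / 4) (9 / 4) (3 / 2) (3 / 2)) v G →
      (∃ C : ℝ≥0, ∀ᵐ t ∂(volume.restrict (Ioo (-(3 / 2 : ℝ) ^ 2) 0)),
        ∫⁻ x in shell (3 / 4) (9 / 4) (3 / 2), ‖v t x‖ₑ ^ 2 ≤ C) →
      ∫⁻ z in shellCyl (3 / 4) (9 / 4) (3 / 2) (3 / 2),
          ENNReal.ofReal (frobeniusNormSq (G z.1 z.2)) < ⊤ →
        ∀ m a : ℝ≥0,
          ∫⁻ z in shellCyl (3 / 4) (9 / 4) (3 / 2) (3 / 2), ‖v z.1 z.2‖ₑ ^ (6 : ℕ) ≤ m →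
          ∫⁻ z in shellCyl (3 / 4) (9 / 4) (3 / 2) (3 / 2), ‖p z.1 z.2‖ₑ ^ (3 / 2 : ℝ) ≤ a →
            ∀ᵐ z ∂(volume.restrict (shellCyl 1 2 1 1)),
              ‖v z.1 z.2‖ + Real.sqrt (frobeniusNormSq (G z.1 z.2)) ≤ Φ₀ m a

/-- **Seregin–Zajaczkowski 2007, Corollary 4.4.** "Under assumptions of Proposition 4.1, there
exists a non-decreasing function `Φ₆ : ℝ₊ → ℝ₊` such that `∫_{Q̃₂} |V|⁶ dz ≤ Φ₆(𝒜₂)`", where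
`Q̃₂ = 𝒞̃₂ × ]-(3/2)², 0[`, `𝒞̃₂ = 𝒞(3/8, 5/2; 3/2)`, and `𝒜₂ = sup_{-2²<t<0} ∫_𝒞̃ |V|² +
∫_Q̃ (|∇V|² + |V|³ + |P|^{3/2})` is the functional of Prop. 4.1 on `Q̃ = 𝒞(1/4,3;2) × ]-2²,0[`
(from Lemmas 4.2 and 4.3: energy estimates for `ω_φ/ϱ` and `(ϱV_φ)²` with cut-offs, Ladyzhenskaya's
inequality in `(ϱ, x₃)`). Rendered (module docstring): the assumptions of Prop. 4.1 are
`IsSmoothAxisymmetricSolutionOn Q̃ V P`; `𝒜₂` is the accepted `SereginSverak2009.szEnergy` with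
the classical gradient; `Φ₆` chosen before the solution and fed an upper bound `K ≥ 𝒜₂`.
[cite: SereginZajaczkowski2007, Cor. 4.4 ((4.19))] -/
def OffAxisL6Bound : Prop :=
  ∃ Φ₆ : ℝ≥0 → ℝ≥0, Monotone Φ₆ ∧
    ∀ (V : ℝ → ℝ³ → ℝ³) (P : ℝ → ℝ³ → ℝ),
      IsSmoothAxisymmetricSolutionOn (shellCylOpens (1 / 4) 3 2 2) V P →
      ∀ K : ℝ≥0, szEnergy V P (fun t x => fderiv ℝ (V t) x) ≤ K →
        ∫⁻ z in shellCyl (3 / 8) (5 / 2) (3 / 2) (3 / 2), ‖V z.1 z.2‖ₑ ^ (6 : ℕ) ≤ Φ₆ K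

/-- **Seregin–Zajaczkowski 2007, Proposition 4.1.** "Let `V` and `P` be a sufficiently smooth
axially symmetric solution to the Navier–Stokes equations in `Q̃ = 𝒞̃ × ]-2², 0[`, where
`𝒞̃ = 𝒞(1/4, 3; 2)`. Then, there exists a non-decreasing function `Φ : ℝ₊ → ℝ₊` such that
`sup_{z ∈ 𝒞(1,2;1) × ]-1,0[} (|V(z)| + |∇V(z)|) ≤ Φ(𝒜₂)`, where
`𝒜₂ = sup_{-2²<t<0} ∫_𝒞̃ |V(x,t)|² dx + ∫_Q̃ (|∇V|² + |V|³ + |P|^{3/2}) dz`." Rendered (module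
docstring): hypotheses `IsSmoothAxisymmetricSolutionOn Q̃ V P` (the class the authors apply it
to: suitable weak solution, axially symmetric, all spatial derivatives locally Hölder continuous);
`𝒜₂ = SereginSverak2009.szEnergy V P (D_x V)`; `Φ` chosen before the solution and fed an upper
bound `K ≥ 𝒜₂`; the bound pointwise on the open set `𝒞(1,2;1) × ]-1,0[`, `|∇V| = √(frobeniusNormSq
(D(V t) x))`. This is the inequality (as15) of Seregin–Šverák 2009 at unit scale (`Q̃ =
outerShell 1 0`, `𝒞(1,2;1) × ]-1,0[ = innerShell 1 0`).
[cite: SereginZajaczkowski2007, Prop. 4.1 ((4.1))] -/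
def OffAxisSupBound : Prop :=
  ∃ Φ : ℝ≥0 → ℝ≥0, Monotone Φ ∧
    ∀ (V : ℝ → ℝ³ → ℝ³) (P : ℝ → ℝ³ → ℝ),
      IsSmoothAxisymmetricSolutionOn (shellCylOpens (1 / 4) 3 2 2) V P →
      ∀ K : ℝ≥0, szEnergy V P (fun t x => fderiv ℝ (V t) x) ≤ K →
        ∀ z ∈ shellCyl 1 2 1 1,
          ‖V z.1 z.2‖ + Real.sqrt (frobeniusNormSq (fderiv ℝ (V z.1) z.2)) ≤ Φ K

/-! ### Proved: Proposition 4.1 from Corollary 4.4 and Lemma 2.3 -/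

/-- The squared Frobenius norm depends continuously on the linear map (a finite sum of squares of
norms of evaluations). [folklore] -/
theorem continuous_frobeniusNormSq : Continuous fun L : ℝ³ →L[ℝ] ℝ³ => frobeniusNormSq L := by
  unfold frobeniusNormSq
  refine continuous_finsetSum _ fun i _ => ?_
  exact ((ContinuousLinearMap.apply ℝ ℝ³ (stdOrthonormalBasis ℝ ℝ³ i)).continuous.norm).pow 2

/-- The pressure term is dominated by `𝒜₂`: `∫_Q̂ |P|^{3/2} ≤ ∫_Q̃ |P|^{3/2} ≤ 𝒜₂`.
[cite: SereginZajaczkowski2007, proof of Prop. 4.1 (𝒜_* ≤ 𝒜₂)] -/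
theorem lintegral_pressure_hat_le_szEnergy (V : ℝ → ℝ³ → ℝ³) (P : ℝ → ℝ³ → ℝ)
    (G : ℝ → ℝ³ → ℝ³ →L[ℝ] ℝ³) :
    ∫⁻ z in shellCyl (3 / 4) (9 / 4) (3 / 2) (3 / 2), ‖P z.1 z.2‖ₑ ^ (3 / 2 : ℝ) ≤
      szEnergy V P G := by
  calc ∫⁻ z in shellCyl (3 / 4) (9 / 4) (3 / 2) (3 / 2), ‖P z.1 z.2‖ₑ ^ (3 / 2 : ℝ)
      ≤ ∫⁻ z in outerShell 1 0, ‖P z.1 z.2‖ₑ ^ (3 / 2 : ℝ) := by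
        rw [outerShell_one_eq]
        exact lintegral_mono_set shellCyl_hat_subset_tilde
    _ ≤ szEnergy V P G := by
        unfold szEnergy
        exact le_add_self

/-- **Seregin–Zajaczkowski 2007, Proposition 4.1, proved from Corollary 4.4 and Lemma 2.3** as
printed ("Applying Corollary 4.4 and Lemma 2.3, we end up with the proof of Proposition 4.1"):
given the assumptions of Prop. 4.1 on `Q̃` and `𝒜₂ ≤ K`, the solution is a suitable weak solution
on `Q̂ ⊆ Q̃` whose classical gradient is a weak gradient there, Cor. 4.4 gives
`∫_Q̂ |V|⁶ ≤ ∫_{Q̃₂} |V|⁶ ≤ Φ₆(K)`, and `𝒜_* ≤ 𝒜₂ ≤ K`; Lemma 2.3 then bounds `|V| + |∇V|` by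
`Φ₀(Φ₆(K), K)` a.e. on `𝒞(1,2;1) × ]-1,0[`, hence everywhere there by continuity.
`Φ = Φ₀(Φ₆(·), ·)` is non-decreasing. [cite: SereginZajaczkowski2007, proof of Prop. 4.1 (§4, last paragraph)] -/
theorem offAxisSupBound_of (h44 : OffAxisL6Bound) (h23 : L6EpsilonRegularity) :
    OffAxisSupBound := by
  obtain ⟨Φ₆, hΦ₆, h44⟩ := h44
  obtain ⟨Φ₀, hΦ₀m, hΦ₀a, h23⟩ := h23
  refine ⟨fun K => Φ₀ (Φ₆ K) K, fun K K' hKK' => (hΦ₀a K (hΦ₆ hKK')).trans (hΦ₀m _ hKK'), ?_⟩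
  intro V P hV K hK
  -- restriction to `Q̂`
  have hle : shellCylOpens (3 / 4) (9 / 4) (3 / 2) (3 / 2) ≤ shellCylOpens (1 / 4) 3 2 2 :=
    shellCyl_hat_subset_tilde
  have hV' := hV.of_le hle
  have hG : HasWeakSpatialGradientOn (shellCylOpens (3 / 4) (9 / 4) (3 / 2) (3 / 2)) V
      fun t x => fderiv ℝ (V t) x :=
    hasWeakSpatialGradientOn_fderiv hV'.continuousOn_velocity hV'.continuousOn_fderiv
      fun z hz => hV'.differentiableAt hz
  -- the two inputs of Lemma 2.3
  have hm : ∫⁻ z in shellCyl (3 / 4) (9 / 4) (3 / 2) (3 / 2), ‖V z.1 z.2‖ₑ ^ (6 : ℕ) ≤ Φ₆ K :=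
    (lintegral_mono_set shellCyl_hat_subset_two).trans (h44 V P hV K hK)
  have ha : ∫⁻ z in shellCyl (3 / 4) (9 / 4) (3 / 2) (3 / 2), ‖P z.1 z.2‖ₑ ^ (3 / 2 : ℝ) ≤ K :=
    (lintegral_pressure_hat_le_szEnergy V P _).trans hK
  -- Def. 1.1's global classes on `Q̂` from `𝒜₂ ≤ K`
  have hKtop : (K : ℝ≥0∞) < ⊤ := ENNReal.coe_lt_top
  have hA : ∃ C : ℝ≥0, ∀ᵐ t ∂(volume.restrict (Ioo (-(3 / 2 : ℝ) ^ 2) 0)),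
      ∫⁻ x in shell (3 / 4) (9 / 4) (3 / 2), ‖V t x‖ₑ ^ 2 ≤ C := by
    refine ⟨K, ?_⟩
    have h1 : ∀ᵐ t ∂(volume.restrict (Ioo (-2 ^ 2 : ℝ) 0)),
        (∫⁻ y in outerShellSpace 1 0, ‖V t y‖ₑ ^ 2) ≤ K := by
      filter_upwards [ENNReal.ae_le_essSup fun s : ℝ =>
        ∫⁻ y in outerShellSpace 1 0, ‖V s y‖ₑ ^ 2] with t ht
      refine ht.trans (le_trans ?_ hK)
      unfold szEnergy
      exact le_add_right (le_add_right le_self_add)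
    have h2 : ∀ᵐ t ∂(volume.restrict (Ioo (-(3 / 2 : ℝ) ^ 2) 0)),
        (∫⁻ y in outerShellSpace 1 0, ‖V t y‖ₑ ^ 2) ≤ K :=
      ae_restrict_of_ae_restrict_of_subset (Ioo_subset_Ioo (by norm_num) le_rfl) h1
    filter_upwards [h2] with t ht
    refine le_trans (lintegral_mono_set fun x hx => ?_) ht
    rw [mem_shell] at hx
    rw [mem_outerShellSpace, sub_zero]
    exact ⟨⟨by linarith [hx.1.1], by linarith [hx.1.2]⟩, by linarith [hx.2]⟩
  have hE : ∫⁻ z in shellCyl (3 / 4) (9 / 4) (3 / 2) (3 / 2),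
      ENNReal.ofReal (frobeniusNormSq (fderiv ℝ (V z.1) z.2)) < ⊤ := by
    refine lt_of_le_of_lt ?_ hKtop
    refine le_trans ?_ hK
    calc ∫⁻ z in shellCyl (3 / 4) (9 / 4) (3 / 2) (3 / 2),
          ENNReal.ofReal (frobeniusNormSq (fderiv ℝ (V z.1) z.2))
        ≤ ∫⁻ z in outerShell 1 0, ENNReal.ofReal (frobeniusNormSq (fderiv ℝ (V z.1) z.2)) := by
          rw [outerShell_one_eq]
          exact lintegral_mono_set shellCyl_hat_subset_tilde
      _ ≤ szEnergy V P (fun t x => fderiv ℝ (V t) x) := by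
          unfold szEnergy
          exact le_add_right (le_add_right le_add_self)
  have hae := h23 V P _ hV'.suitable hG hA hE (Φ₆ K) K hm ha
  -- continuity of `|V| + |∇V|` on the target set, and the pointwise bound
  have hsub : shellCyl 1 2 1 1 ⊆ (shellCylOpens (1 / 4) 3 2 2 : Set (ℝ × ℝ³)) :=
    shellCyl_one_subset_hat.trans shellCyl_hat_subset_tilde
  have hcont : ContinuousOn (fun z : ℝ × ℝ³ =>
      ‖V z.1 z.2‖ + Real.sqrt (frobeniusNormSq (fderiv ℝ (V z.1) z.2))) (shellCyl 1 2 1 1) := by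
    refine ContinuousOn.add ?_ ?_
    · exact (hV.continuousOn_velocity.mono hsub).norm
    · exact ((continuous_frobeniusNormSq.comp_continuousOn
        (hV.continuousOn_fderiv.mono hsub)).sqrt)
  exact forall_le_of_ae_le_of_continuousOn (isOpen_shellCyl 1 2 1 1) hcont continuousOn_const hae

end SereginZajaczkowski2007

end Literature.Analysis.FluidPDE
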